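import Summits.ResolutionOfSingularities.ResolutionOfSingularities.Theorems.WildQuotientsSummitReductionStubPairOrbitNormalFormBlowupChartsOverCentreCharts
import Summits.ResolutionOfSingularities.ResolutionOfSingularities.Theorems.WildQuotientsSummitReductionStubPairOrbitNormalFormBlowupModelSing
import Literature.AlgebraicGeometry.Resolution.FormalNormalCrossingsLemmas
import HarnessLib

/-!
# `WildQuotients.SummitReduction` (stmt-ResolutionOfSingularities-16324), line `FramePerfect`, stub O3
# (`stub_pair_orbitNormalFormBlowup_chartsOverCentre`): the chart "`t₁ ≠ 0`" of the model retracts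
# onto the chart of the blow-up of the base

Route `ResolutionOfSingularities/WildQuotients`, crux `SummitReduction`; helper file of stub O3
(de Jong 1996, 4.27 [C2] on the coefficient-free model `A⟦u, v⟧/(uv - xy ∏ w_k)`). The model
is plugged into the coefficient-free chart computation: `P = A⟦X₀, X₁⟧` is regular local with the
regular system of parameters `(X₀, X₁, x, y, w)` for a regular system of parameters `(x, y, w)`
of `A` (`chartsOverCentre_model_rsop`). The algebraic heart of the KEY SIMPLIFICATION
"`A'⟦U, V⟧ ↠ L̂` is an isomorphism" for the nodes of the blown-up model (de Jong 1996, p. 76,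
chart "`t₁ ≠ 0`": "`u'v' - t₂'t₃ ⋯ t_s = 0` … again of normal form") is PROVED here:

* `chartsOverCentre_section` — the chart `A[(x, y)/x]` of the blow-up of `A` along `(x, y)` is a
  RETRACT of the chart `P[𝔓/x]` of the blow-up of `P` along `𝔓 = (X₀, X₁, x, y)` (maps of
  blow-up algebras along `A → P → A`, Görtz–Wedhorn 13.96 (2)), the retraction being onto with
  kernel killed by powers of `x` into `(X₀/x, X₁/x)`;
* `chartsOverCentre_section_local` — at a maximal `𝔔 ∋ X₀/x, X₁/x` over `𝔪_P` (a closed point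
  of the new double locus `u' = v' = 0` over the closed point): every element of `L = P[𝔓/x]_𝔔`
  is congruent to its retraction modulo `(X₀/x, X₁/x)`, `𝔔₁ = λ⁻¹𝔔` is a maximal ideal of
  `A[(x, y)/x]` over `𝔪_A`, `𝔪_L = (X₀/x, X₁/x) + 𝔔₁ L`, and the residue fields of `L` and
  `A[(x, y)/x]_{𝔔₁}` agree — so that, after completion, `U ↦ X₀/x`, `V ↦ X₁/x` presents `L̂`
  as `Â₁⟦U, V⟧`, `Â₁` the completion of `A[(x, y)/x]_{𝔔₁}` (the new base `A'`).

## Sources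

* A. J. de Jong, *Smoothness, semi-stability and alterations*, Publ. Math. IHÉS 83 (1996), 4.27,
  p. 76. [DeJong1996]
* A. J. de Jong, *Families of curves and alterations*, Ann. Inst. Fourier 47 (1997), proof of
  Prop. 5.11, p. 619. [DeJong1997]
* U. Görtz, T. Wedhorn, *Algebraic Geometry I*, 2nd ed. (2020), Prop. 13.96 (2), p. 416.
  [GortzWedhorn2020]
* H. Matsumura, *Commutative Ring Theory* (1986), Thm. 15.4. [Matsumura1987]
-/

set_option linter.dupNamespace false -- the tree's summit namespace repeats `ResolutionOfSingularities`

noncomputable section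

open IsLocalRing
open Literature.AlgebraicGeometry.Resolution
open Literature.NumberTheory.GaloisRepresentations.NearlyOrdinaryPresentationCA

namespace Summit.ResolutionOfSingularities.ResolutionOfSingularities.Theorems

/-! ## The model: `P = A⟦X₀, X₁⟧`, centre `(X₀, X₁, x, y)`, chart `P[𝔓/x]` -/

/-- **The regular system of parameters of `A⟦X₀, X₁⟧`**: `(X₀, X₁, x, y, w)` for a regular
system of parameters `(x, y, w)` of `A` (`𝔪_{A⟦X⟧} = 𝔪_A A⟦X⟧ + (X)`, and
`dim A⟦X₀, X₁⟧ = dim A + 2`). [cite: Matsumura1987, Thm. 15.4] -/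
theorem chartsOverCentre_model_rsop {A : Type} [CommRing A] [IsRegularLocalRing A] {l : ℕ}
    (x y : A) (w : Fin l → A)
    (hzA : Ideal.span (Set.range (Fin.append ![x, y] w)) = maximalIdeal A)
    (hdA : (maximalIdeal A).spanFinrank = 2 + l) :
    Ideal.span (Set.range (Fin.append
        (![MvPowerSeries.X 0, MvPowerSeries.X 1, MvPowerSeries.C x, MvPowerSeries.C y] :
          Fin 4 → MvPowerSeries (Fin 2) A)
        (fun k => MvPowerSeries.C (w k)))) = maximalIdeal (MvPowerSeries (Fin 2) A) ∧
    (maximalIdeal (MvPowerSeries (Fin 2) A)).spanFinrank = 4 + l := by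
  classical
  haveI := isRegularLocalRing_mvPowerSeries_of_isRegularLocalRing A 2
  -- the range of the family
  have hr : Set.range (Fin.append
      (![MvPowerSeries.X 0, MvPowerSeries.X 1, MvPowerSeries.C x, MvPowerSeries.C y] :
        Fin 4 → MvPowerSeries (Fin 2) A) (fun k => MvPowerSeries.C (w k))) =
      Set.range (MvPowerSeries.X : Fin 2 → MvPowerSeries (Fin 2) A) ∪
        (MvPowerSeries.C (σ := Fin 2) (R := A)) '' Set.range (Fin.append ![x, y] w) := by
    ext f
    simp only [Set.mem_range, Set.mem_union, Set.mem_image]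
    constructor
    · rintro ⟨i, rfl⟩
      refine Fin.addCases (fun i => ?_) (fun k => ?_) i
      · rw [Fin.append_left]
        fin_cases i
        · exact Or.inl ⟨0, rfl⟩
        · exact Or.inl ⟨1, rfl⟩
        · exact Or.inr ⟨x, ⟨Fin.castAdd l 0, by simp⟩, rfl⟩
        · exact Or.inr ⟨y, ⟨Fin.castAdd l 1, by simp⟩, rfl⟩
      · rw [Fin.append_right]
        exact Or.inr ⟨w k, ⟨Fin.natAdd 2 k, by simp⟩, rfl⟩
    · rintro (⟨i, rfl⟩ | ⟨a, ⟨i, rfl⟩, rfl⟩)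
      · fin_cases i
        · exact ⟨Fin.castAdd l 0, by simp⟩
        · exact ⟨Fin.castAdd l 1, by simp⟩
      · refine Fin.addCases (fun i => ?_) (fun k => ?_) i
        · fin_cases i
          · exact ⟨Fin.castAdd l 2, by simp⟩
          · exact ⟨Fin.castAdd l 3, by simp⟩
        · exact ⟨Fin.natAdd 4 k, by simp⟩
  have hspan : Ideal.span (Set.range (Fin.append
      (![MvPowerSeries.X 0, MvPowerSeries.X 1, MvPowerSeries.C x, MvPowerSeries.C y] :
        Fin 4 → MvPowerSeries (Fin 2) A) (fun k => MvPowerSeries.C (w k)))) =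
      maximalIdeal (MvPowerSeries (Fin 2) A) := by
    rw [hr, Ideal.span_union, ← Ideal.map_span, hzA, maximalIdeal_mvPowerSeries_eq A 2, sup_comm]
  refine ⟨hspan, ?_⟩
  -- the count: `dim P ≥ dim A + 2 = 4 + l` and `𝔪_P` has `4 + l` generators
  have hdimA : ringKrullDim A = (2 + l : ℕ) := by
    rw [← IsRegularLocalRing.spanFinrank_maximalIdeal (R := A), hdA]
  have hge := ringKrullDim_add_le_ringKrullDim_mvPowerSeries A 2
  rw [hdimA] at hge
  have hfin := IsRegularLocalRing.spanFinrank_maximalIdeal (R := MvPowerSeries (Fin 2) A)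
  have hle : (maximalIdeal (MvPowerSeries (Fin 2) A)).spanFinrank ≤ 4 + l := by
    rw [← hspan]
    refine (Submodule.spanFinrank_span_le_ncard_of_finite (Set.finite_range _)).trans ?_
    rw [← Set.image_univ]
    refine (Set.ncard_image_le Set.finite_univ).trans ?_
    rw [Set.ncard_univ, Nat.card_eq_fintype_card, Fintype.card_fin]
  apply le_antisymm hle
  have : ((4 + l : ℕ) : WithBot ℕ∞) ≤ (maximalIdeal (MvPowerSeries (Fin 2) A)).spanFinrank := by
    rw [hfin]
    refine le_trans ?_ hge
    push_cast
    exact le_of_eq (by ring)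
  exact_mod_cast this

/-- **The chart `A[(x, y)/x]` of the blow-up of `A` along `(x, y)` is a retract of the chart
`P[𝔓/x]`** of the blow-up of `P = A⟦X₀, X₁⟧` along `𝔓 = (X₀, X₁, x, y)`: the maps of blow-up
algebras along `A → P` (constants) and `P → A` (constant coefficient) compose to the identity,
the second is onto, and its kernel is killed by a power of `x` into `(X₀/x, X₁/x)`
(`mem_ker_blowupAlgebraMap_iff`: the `x`-saturation of `(X₀, X₁) P[𝔓/x] = x · (X₀/x, X₁/x)`).
This is the algebraic input of "`A'⟦U, V⟧ ↠ L̂`" on the chart "`t₁ ≠ 0`".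
[cite: DeJong1996, 4.27, p. 76] [cite: GortzWedhorn2020, Prop. 13.96 (2) (proof), p. 416] -/
theorem chartsOverCentre_section {A : Type} [CommRing A] (x y : A)
    (hy : y ∈ (Ideal.span (Set.range ![x, y]))) (h0 : MvPowerSeries.X 0 ∈ (Ideal.span (Set.range (![MvPowerSeries.X 0, MvPowerSeries.X 1, MvPowerSeries.C x, MvPowerSeries.C y] : Fin 4 → MvPowerSeries (Fin 2) A)))) (h1 : MvPowerSeries.X 1 ∈ (Ideal.span (Set.range (![MvPowerSeries.X 0, MvPowerSeries.X 1, MvPowerSeries.C x, MvPowerSeries.C y] : Fin 4 → MvPowerSeries (Fin 2) A))))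
    (h3 : MvPowerSeries.C y ∈ (Ideal.span (Set.range (![MvPowerSeries.X 0, MvPowerSeries.X 1, MvPowerSeries.C x, MvPowerSeries.C y] : Fin 4 → MvPowerSeries (Fin 2) A)))) :
    ∃ (lam : blowupAlgebra (Ideal.span (Set.range ![x, y])) x →+* blowupAlgebra (Ideal.span (Set.range (![MvPowerSeries.X 0, MvPowerSeries.X 1, MvPowerSeries.C x, MvPowerSeries.C y] : Fin 4 → MvPowerSeries (Fin 2) A))) (MvPowerSeries.C x))
      (phi : blowupAlgebra (Ideal.span (Set.range (![MvPowerSeries.X 0, MvPowerSeries.X 1, MvPowerSeries.C x, MvPowerSeries.C y] : Fin 4 → MvPowerSeries (Fin 2) A))) (MvPowerSeries.C x) →+* blowupAlgebra (Ideal.span (Set.range ![x, y])) x),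
      (∀ a, phi (lam a) = a) ∧ Function.Surjective phi ∧
      (∀ a : A, lam (algebraMap A _ a) = algebraMap (MvPowerSeries (Fin 2) A) _ (MvPowerSeries.C a)) ∧
      lam (blowupAlgebra.gen (Ideal.span (Set.range ![x, y])) x y hy) =
        blowupAlgebra.gen (Ideal.span (Set.range (![MvPowerSeries.X 0, MvPowerSeries.X 1, MvPowerSeries.C x, MvPowerSeries.C y] : Fin 4 → MvPowerSeries (Fin 2) A))) (MvPowerSeries.C x) (MvPowerSeries.C y) h3 ∧
      (∀ a : A, phi (algebraMap (MvPowerSeries (Fin 2) A) _ (MvPowerSeries.C a)) = algebraMap A _ a) ∧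
      (∀ b, ∃ N : ℕ, algebraMap (MvPowerSeries (Fin 2) A) _ (MvPowerSeries.C x) ^ N * (b - lam (phi b)) ∈
        Ideal.span {blowupAlgebra.gen (Ideal.span (Set.range (![MvPowerSeries.X 0, MvPowerSeries.X 1, MvPowerSeries.C x, MvPowerSeries.C y] : Fin 4 → MvPowerSeries (Fin 2) A))) (MvPowerSeries.C x) (MvPowerSeries.X 0) h0,
          blowupAlgebra.gen (Ideal.span (Set.range (![MvPowerSeries.X 0, MvPowerSeries.X 1, MvPowerSeries.C x, MvPowerSeries.C y] : Fin 4 → MvPowerSeries (Fin 2) A))) (MvPowerSeries.C x) (MvPowerSeries.X 1) h1}) := by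
  classical
  -- the two ideals correspond
  have hI : ((Ideal.span (Set.range ![x, y]))).map (MvPowerSeries.C (σ := Fin 2) (R := A)) ≤ (Ideal.span (Set.range (![MvPowerSeries.X 0, MvPowerSeries.X 1, MvPowerSeries.C x, MvPowerSeries.C y] : Fin 4 → MvPowerSeries (Fin 2) A))) := by
    rw [Ideal.map_span]
    refine Ideal.span_le.mpr ?_
    rintro _ ⟨_, ⟨i, rfl⟩, rfl⟩
    fin_cases i
    · exact Ideal.subset_span ⟨2, rfl⟩
    · exact Ideal.subset_span ⟨3, rfl⟩
  have hq : ((Ideal.span (Set.range (![MvPowerSeries.X 0, MvPowerSeries.X 1, MvPowerSeries.C x, MvPowerSeries.C y] : Fin 4 → MvPowerSeries (Fin 2) A)))).map (MvPowerSeries.constantCoeff : MvPowerSeries (Fin 2) A →+* A) ≤ (Ideal.span (Set.range ![x, y])) := by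
    rw [Ideal.map_span]
    refine Ideal.span_le.mpr ?_
    rintro _ ⟨_, ⟨i, rfl⟩, rfl⟩
    fin_cases i
    · simp
    · simp
    · exact Ideal.subset_span ⟨0, by simp⟩
    · exact Ideal.subset_span ⟨1, by simp⟩
  have hq' : (Ideal.span (Set.range ![x, y])) ≤ ((Ideal.span (Set.range (![MvPowerSeries.X 0, MvPowerSeries.X 1, MvPowerSeries.C x, MvPowerSeries.C y] : Fin 4 → MvPowerSeries (Fin 2) A)))).map (MvPowerSeries.constantCoeff : MvPowerSeries (Fin 2) A →+* A) := by
    refine Ideal.span_le.mpr ?_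
    rintro _ ⟨i, rfl⟩
    fin_cases i
    · have := Ideal.mem_map_of_mem (MvPowerSeries.constantCoeff : MvPowerSeries (Fin 2) A →+* A)
        (Ideal.subset_span (s := Set.range (![MvPowerSeries.X 0, MvPowerSeries.X 1, MvPowerSeries.C x, MvPowerSeries.C y] : Fin 4 → MvPowerSeries (Fin 2) A)) ⟨2, rfl⟩)
      simpa using this
    · have := Ideal.mem_map_of_mem (MvPowerSeries.constantCoeff : MvPowerSeries (Fin 2) A →+* A) h3
      simpa using this
  let lam := blowupAlgebraMap (MvPowerSeries.C (σ := Fin 2) (R := A)) (Ideal.span (Set.range ![x, y])) (Ideal.span (Set.range (![MvPowerSeries.X 0, MvPowerSeries.X 1, MvPowerSeries.C x, MvPowerSeries.C y] : Fin 4 → MvPowerSeries (Fin 2) A))) x hI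
  let phi : blowupAlgebra (Ideal.span (Set.range (![MvPowerSeries.X 0, MvPowerSeries.X 1, MvPowerSeries.C x, MvPowerSeries.C y] : Fin 4 → MvPowerSeries (Fin 2) A))) (MvPowerSeries.C x) →+* blowupAlgebra (Ideal.span (Set.range ![x, y])) x :=
    blowupAlgebraMap (MvPowerSeries.constantCoeff : MvPowerSeries (Fin 2) A →+* A) (Ideal.span (Set.range (![MvPowerSeries.X 0, MvPowerSeries.X 1, MvPowerSeries.C x, MvPowerSeries.C y] : Fin 4 → MvPowerSeries (Fin 2) A))) (Ideal.span (Set.range ![x, y]))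
      (MvPowerSeries.C x) hq
  have hlamC : ∀ a : A, lam (algebraMap A _ a) = algebraMap (MvPowerSeries (Fin 2) A) _ (MvPowerSeries.C a) :=
    fun a => blowupAlgebraMap_algebraMap _ _ _ _ hI a
  have hphiC : ∀ a : A, phi (algebraMap (MvPowerSeries (Fin 2) A) _ (MvPowerSeries.C a)) = algebraMap A _ a := by
    intro a
    have := blowupAlgebraMap_algebraMap (MvPowerSeries.constantCoeff : MvPowerSeries (Fin 2) A →+* A)
      (Ideal.span (Set.range (![MvPowerSeries.X 0, MvPowerSeries.X 1, MvPowerSeries.C x, MvPowerSeries.C y] : Fin 4 → MvPowerSeries (Fin 2) A))) (Ideal.span (Set.range ![x, y])) (MvPowerSeries.C x) hq (MvPowerSeries.C a)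
    exact this
  -- `phi ∘ lam = id`: both fix `A`, and `x` is a non-zero-divisor of `A[(x, y)/x]`
  have hsec : ∀ a, phi (lam a) = a := by
    intro g
    obtain ⟨M, r, hr⟩ := blowupAlgebra.exists_pow_mul_eq_algebraMap (Ideal.span (Set.range ![x, y])) x g
    have h1 : algebraMap A (blowupAlgebra (Ideal.span (Set.range ![x, y])) x) x ^ M * phi (lam g) = algebraMap A _ r := by
      have := congrArg (fun z => phi (lam z)) hr
      simp only [map_mul, map_pow, hlamC, hphiC] at this
      exact this
    rw [← hr] at h1
    exact (mul_left_mem_nonZeroDivisors_eq_zero_iff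
      (pow_mem (algebraMap_mem_nonZeroDivisors_blowupAlgebra (I := (Ideal.span (Set.range ![x, y]))) (a := x)) M)).mp
      (by rw [mul_sub, h1, sub_self]) |> sub_eq_zero.mp
  have hsurj : Function.Surjective phi :=
    blowupAlgebraMap_surjective _ _ _ _ (fun a => ⟨MvPowerSeries.C a, rfl⟩) hq hq'
  refine ⟨lam, phi, hsec, hsurj, hlamC, ?_, hphiC, fun b => ?_⟩
  · exact blowupAlgebraMap_gen _ _ _ _ hI y hy
  · -- `b - lam (phi b)` lies in the kernel of `phi`
    have hker : b - lam (phi b) ∈ RingHom.ker phi := by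
      rw [RingHom.mem_ker, map_sub, hsec, sub_self]
    obtain ⟨N, hN⟩ := (mem_ker_blowupAlgebraMap_iff _ _ _ _ hq _).mp hker
    refine ⟨N, ?_⟩
    -- `(ker constantCoeff) P[𝔓/x] ⊆ (X₀/x, X₁/x)`
    have hle : (RingHom.ker (MvPowerSeries.constantCoeff : MvPowerSeries (Fin 2) A →+* A)).map
        (algebraMap (MvPowerSeries (Fin 2) A) (blowupAlgebra (Ideal.span (Set.range (![MvPowerSeries.X 0, MvPowerSeries.X 1, MvPowerSeries.C x, MvPowerSeries.C y] : Fin 4 → MvPowerSeries (Fin 2) A))) (MvPowerSeries.C x))) ≤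
        Ideal.span {blowupAlgebra.gen (Ideal.span (Set.range (![MvPowerSeries.X 0, MvPowerSeries.X 1, MvPowerSeries.C x, MvPowerSeries.C y] : Fin 4 → MvPowerSeries (Fin 2) A))) (MvPowerSeries.C x) (MvPowerSeries.X 0) h0,
          blowupAlgebra.gen (Ideal.span (Set.range (![MvPowerSeries.X 0, MvPowerSeries.X 1, MvPowerSeries.C x, MvPowerSeries.C y] : Fin 4 → MvPowerSeries (Fin 2) A))) (MvPowerSeries.C x) (MvPowerSeries.X 1) h1} := by
      rw [Ideal.map_le_iff_le_comap]
      intro f hf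
      rw [RingHom.mem_ker] at hf
      have hfX := MvPowerSeries.mem_span_range_X_of_constantCoeff_eq_zero hf
      rw [Ideal.mem_comap]
      have hXle : Ideal.span (Set.range (MvPowerSeries.X : Fin 2 → MvPowerSeries (Fin 2) A)) ≤
          (Ideal.span {blowupAlgebra.gen (Ideal.span (Set.range (![MvPowerSeries.X 0, MvPowerSeries.X 1, MvPowerSeries.C x, MvPowerSeries.C y] : Fin 4 → MvPowerSeries (Fin 2) A))) (MvPowerSeries.C x) (MvPowerSeries.X 0) h0,
            blowupAlgebra.gen (Ideal.span (Set.range (![MvPowerSeries.X 0, MvPowerSeries.X 1, MvPowerSeries.C x, MvPowerSeries.C y] : Fin 4 → MvPowerSeries (Fin 2) A))) (MvPowerSeries.C x) (MvPowerSeries.X 1) h1}).comap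
            (algebraMap (MvPowerSeries (Fin 2) A) (blowupAlgebra (Ideal.span (Set.range (![MvPowerSeries.X 0, MvPowerSeries.X 1, MvPowerSeries.C x, MvPowerSeries.C y] : Fin 4 → MvPowerSeries (Fin 2) A))) (MvPowerSeries.C x))) := by
        refine Ideal.span_le.mpr ?_
        rintro _ ⟨i, rfl⟩
        rw [SetLike.mem_coe, Ideal.mem_comap]
        fin_cases i
        · change algebraMap (MvPowerSeries (Fin 2) A) (blowupAlgebra (Ideal.span (Set.range (![MvPowerSeries.X 0, MvPowerSeries.X 1, MvPowerSeries.C x, MvPowerSeries.C y] : Fin 4 → MvPowerSeries (Fin 2) A))) (MvPowerSeries.C x))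
            (MvPowerSeries.X 0) ∈ _
          rw [show algebraMap (MvPowerSeries (Fin 2) A) (blowupAlgebra (Ideal.span (Set.range (![MvPowerSeries.X 0, MvPowerSeries.X 1, MvPowerSeries.C x, MvPowerSeries.C y] : Fin 4 → MvPowerSeries (Fin 2) A))) (MvPowerSeries.C x))
              (MvPowerSeries.X 0) = blowupAlgebra.gen (Ideal.span (Set.range (![MvPowerSeries.X 0, MvPowerSeries.X 1, MvPowerSeries.C x, MvPowerSeries.C y] : Fin 4 → MvPowerSeries (Fin 2) A))) (MvPowerSeries.C x) (MvPowerSeries.X 0) h0 *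
              algebraMap _ _ (MvPowerSeries.C x) from (blowupAlgebra.gen_mul_algebraMap _ _ _ h0).symm]
          exact Ideal.mul_mem_right _ _ (Ideal.subset_span (Set.mem_insert _ _))
        · change algebraMap (MvPowerSeries (Fin 2) A) (blowupAlgebra (Ideal.span (Set.range (![MvPowerSeries.X 0, MvPowerSeries.X 1, MvPowerSeries.C x, MvPowerSeries.C y] : Fin 4 → MvPowerSeries (Fin 2) A))) (MvPowerSeries.C x))
            (MvPowerSeries.X 1) ∈ _
          rw [show algebraMap (MvPowerSeries (Fin 2) A) (blowupAlgebra (Ideal.span (Set.range (![MvPowerSeries.X 0, MvPowerSeries.X 1, MvPowerSeries.C x, MvPowerSeries.C y] : Fin 4 → MvPowerSeries (Fin 2) A))) (MvPowerSeries.C x))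
              (MvPowerSeries.X 1) = blowupAlgebra.gen (Ideal.span (Set.range (![MvPowerSeries.X 0, MvPowerSeries.X 1, MvPowerSeries.C x, MvPowerSeries.C y] : Fin 4 → MvPowerSeries (Fin 2) A))) (MvPowerSeries.C x) (MvPowerSeries.X 1) h1 *
              algebraMap _ _ (MvPowerSeries.C x) from (blowupAlgebra.gen_mul_algebraMap _ _ _ h1).symm]
          exact Ideal.mul_mem_right _ _ (Ideal.subset_span (Set.mem_insert_of_mem _ rfl))
      exact hXle hfX
    exact hle hN

/-- `chartsOverCentre_isRsopPart_chartFamily` with the chart element given up to equality (for the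
specialisation to the model, whose chart element `c j` is a vector entry). [folklore] -/
theorem chartsOverCentre_isRsopPart_chartFamily_of_eq {R : Type} [CommRing R] [IsRegularLocalRing R]
    {n : ℕ} (c : Fin n → R) (j : Fin n) {l : ℕ} (w : Fin l → R)
    (hz : Ideal.span (Set.range (Fin.append c w)) = maximalIdeal R)
    (hd : (maximalIdeal R).spanFinrank = n + l)
    (𝔓 : Ideal R) (h𝔓 : 𝔓 = Ideal.span (Set.range c)) (hc : ∀ k, c k ∈ 𝔓) (b : R) (hb : c j = b)
    (𝔔 : Ideal (blowupAlgebra 𝔓 b)) [𝔔.IsPrime]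
    (h𝔔 : 𝔔.comap (algebraMap R _) = maximalIdeal R)
    (L : Type) [CommRing L] [IsLocalRing L] [Algebra (blowupAlgebra 𝔓 b) L]
    [IsLocalization.AtPrime L 𝔔] {a : ℕ} (jJ : Fin a → {k : Fin n // k ≠ j})
    (hjJ : Function.Injective jJ)
    (hJ : ∀ t, blowupAlgebra.gen 𝔓 b (c (jJ t).1) (hc _) ∈ 𝔔) :
    IsRsopPart (chartFamily c j w L (algebraMap R (blowupAlgebra 𝔓 b))
      (fun k => blowupAlgebra.gen 𝔓 b (c k) (hc k)) jJ) := by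
  subst hb
  exact chartsOverCentre_isRsopPart_chartFamily c j w hz hd 𝔓 h𝔓 hc 𝔔 h𝔔 L jJ hjJ hJ

/-- **The retract at a closed point of the double locus over the closed point.** For a maximal
`𝔔 ∋ X₀/x, X₁/x` of `P[𝔓/x]` over `𝔪_P` and `L = P[𝔓/x]_𝔔`: every element of `P[𝔓/x]` differs
from its retraction by an element of `(X₀/x, X₁/x) L` (the ring `L/(X₀/x, X₁/x)` is a regular local
domain in which `x ≠ 0`); hence `𝔔₁ = λ⁻¹𝔔` is a maximal ideal of `A[(x, y)/x]` over `𝔪_A`,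
`𝔪_L = (X₀/x, X₁/x) + 𝔔₁ L`, and `L` has the same residue field as `A[(x, y)/x]_{𝔔₁}`.
[cite: DeJong1996, 4.27, p. 76] -/
theorem chartsOverCentre_section_local {A : Type} [CommRing A] [IsRegularLocalRing A] {l : ℕ}
    (x y : A) (w : Fin l → A)
    (hzA : Ideal.span (Set.range (Fin.append ![x, y] w)) = maximalIdeal A)
    (hdA : (maximalIdeal A).spanFinrank = 2 + l)
    (hy : y ∈ (Ideal.span (Set.range ![x, y]))) (h0 : MvPowerSeries.X 0 ∈ (Ideal.span (Set.range (![MvPowerSeries.X 0, MvPowerSeries.X 1, MvPowerSeries.C x, MvPowerSeries.C y] : Fin 4 → MvPowerSeries (Fin 2) A)))) (h1 : MvPowerSeries.X 1 ∈ (Ideal.span (Set.range (![MvPowerSeries.X 0, MvPowerSeries.X 1, MvPowerSeries.C x, MvPowerSeries.C y] : Fin 4 → MvPowerSeries (Fin 2) A))))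
    (h3 : MvPowerSeries.C y ∈ (Ideal.span (Set.range (![MvPowerSeries.X 0, MvPowerSeries.X 1, MvPowerSeries.C x, MvPowerSeries.C y] : Fin 4 → MvPowerSeries (Fin 2) A))))
    (𝔔 : Ideal (blowupAlgebra (Ideal.span (Set.range (![MvPowerSeries.X 0, MvPowerSeries.X 1, MvPowerSeries.C x, MvPowerSeries.C y] : Fin 4 → MvPowerSeries (Fin 2) A))) (MvPowerSeries.C x))) [𝔔.IsMaximal]
    (h𝔔 : 𝔔.comap (algebraMap (MvPowerSeries (Fin 2) A) (blowupAlgebra (Ideal.span (Set.range (![MvPowerSeries.X 0, MvPowerSeries.X 1, MvPowerSeries.C x, MvPowerSeries.C y] : Fin 4 → MvPowerSeries (Fin 2) A))) (MvPowerSeries.C x))) = maximalIdeal (MvPowerSeries (Fin 2) A))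
    (he0 : blowupAlgebra.gen (Ideal.span (Set.range (![MvPowerSeries.X 0, MvPowerSeries.X 1, MvPowerSeries.C x, MvPowerSeries.C y] : Fin 4 → MvPowerSeries (Fin 2) A))) (MvPowerSeries.C x) (MvPowerSeries.X 0) h0 ∈ 𝔔) (he1 : blowupAlgebra.gen (Ideal.span (Set.range (![MvPowerSeries.X 0, MvPowerSeries.X 1, MvPowerSeries.C x, MvPowerSeries.C y] : Fin 4 → MvPowerSeries (Fin 2) A))) (MvPowerSeries.C x) (MvPowerSeries.X 1) h1 ∈ 𝔔)
    (L : Type) [CommRing L] [IsLocalRing L] [Algebra (blowupAlgebra (Ideal.span (Set.range (![MvPowerSeries.X 0, MvPowerSeries.X 1, MvPowerSeries.C x, MvPowerSeries.C y] : Fin 4 → MvPowerSeries (Fin 2) A))) (MvPowerSeries.C x)) L] [IsLocalization.AtPrime L 𝔔] :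
    ∃ (lam : blowupAlgebra (Ideal.span (Set.range ![x, y])) x →+* blowupAlgebra (Ideal.span (Set.range (![MvPowerSeries.X 0, MvPowerSeries.X 1, MvPowerSeries.C x, MvPowerSeries.C y] : Fin 4 → MvPowerSeries (Fin 2) A))) (MvPowerSeries.C x)) (phi : blowupAlgebra (Ideal.span (Set.range (![MvPowerSeries.X 0, MvPowerSeries.X 1, MvPowerSeries.C x, MvPowerSeries.C y] : Fin 4 → MvPowerSeries (Fin 2) A))) (MvPowerSeries.C x) →+* blowupAlgebra (Ideal.span (Set.range ![x, y])) x),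
      (∀ a, phi (lam a) = a) ∧ Function.Surjective phi ∧
      (∀ a : A, lam (algebraMap A _ a) = algebraMap (MvPowerSeries (Fin 2) A) (blowupAlgebra (Ideal.span (Set.range (![MvPowerSeries.X 0, MvPowerSeries.X 1, MvPowerSeries.C x, MvPowerSeries.C y] : Fin 4 → MvPowerSeries (Fin 2) A))) (MvPowerSeries.C x)) (MvPowerSeries.C a)) ∧
      lam (blowupAlgebra.gen (Ideal.span (Set.range ![x, y])) x y hy) = blowupAlgebra.gen (Ideal.span (Set.range (![MvPowerSeries.X 0, MvPowerSeries.X 1, MvPowerSeries.C x, MvPowerSeries.C y] : Fin 4 → MvPowerSeries (Fin 2) A))) (MvPowerSeries.C x) (MvPowerSeries.C y) h3 ∧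
      (∀ b, algebraMap (blowupAlgebra (Ideal.span (Set.range (![MvPowerSeries.X 0, MvPowerSeries.X 1, MvPowerSeries.C x, MvPowerSeries.C y] : Fin 4 → MvPowerSeries (Fin 2) A))) (MvPowerSeries.C x)) L b - algebraMap (blowupAlgebra (Ideal.span (Set.range (![MvPowerSeries.X 0, MvPowerSeries.X 1, MvPowerSeries.C x, MvPowerSeries.C y] : Fin 4 → MvPowerSeries (Fin 2) A))) (MvPowerSeries.C x)) L (lam (phi b)) ∈ Ideal.span {algebraMap (blowupAlgebra (Ideal.span (Set.range (![MvPowerSeries.X 0, MvPowerSeries.X 1, MvPowerSeries.C x, MvPowerSeries.C y] : Fin 4 → MvPowerSeries (Fin 2) A))) (MvPowerSeries.C x)) L (blowupAlgebra.gen (Ideal.span (Set.range (![MvPowerSeries.X 0, MvPowerSeries.X 1, MvPowerSeries.C x, MvPowerSeries.C y] : Fin 4 → MvPowerSeries (Fin 2) A))) (MvPowerSeries.C x) (MvPowerSeries.X 0) h0), algebraMap (blowupAlgebra (Ideal.span (Set.range (![MvPowerSeries.X 0, MvPowerSeries.X 1, MvPowerSeries.C x, MvPowerSeries.C y] : Fin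 4 → MvPowerSeries (Fin 2) A))) (MvPowerSeries.C x)) L (blowupAlgebra.gen (Ideal.span (Set.range (![MvPowerSeries.X 0, MvPowerSeries.X 1, MvPowerSeries.C x, MvPowerSeries.C y] : Fin 4 → MvPowerSeries (Fin 2) A))) (MvPowerSeries.C x) (MvPowerSeries.X 1) h1)}) ∧
      (∀ b ∈ 𝔔, phi b ∈ 𝔔.comap lam) ∧ (𝔔.comap lam).IsMaximal ∧
      (𝔔.comap lam).comap (algebraMap A (blowupAlgebra (Ideal.span (Set.range ![x, y])) x)) = maximalIdeal A ∧
      maximalIdeal L = Ideal.span {algebraMap (blowupAlgebra (Ideal.span (Set.range (![MvPowerSeries.X 0, MvPowerSeries.X 1, MvPowerSeries.C x, MvPowerSeries.C y] : Fin 4 → MvPowerSeries (Fin 2) A))) (MvPowerSeries.C x)) L (blowupAlgebra.gen (Ideal.span (Set.range (![MvPowerSeries.X 0, MvPowerSeries.X 1, MvPowerSeries.C x, MvPowerSeries.C y] : Fin 4 → MvPowerSeries (Fin 2) A))) (MvPowerSeries.C x) (MvPowerSeries.X 0) h0), algebraMap (blowupAlgebra (Ideal.span (Set.range (![MvPowerSeries.X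 0, MvPowerSeries.X 1, MvPowerSeries.C x, MvPowerSeries.C y] : Fin 4 → MvPowerSeries (Fin 2) A))) (MvPowerSeries.C x)) L (blowupAlgebra.gen (Ideal.span (Set.range (![MvPowerSeries.X 0, MvPowerSeries.X 1, MvPowerSeries.C x, MvPowerSeries.C y] : Fin 4 → MvPowerSeries (Fin 2) A))) (MvPowerSeries.C x) (MvPowerSeries.X 1) h1)} ⊔
        (𝔔.comap lam).map ((algebraMap (blowupAlgebra (Ideal.span (Set.range (![MvPowerSeries.X 0, MvPowerSeries.X 1, MvPowerSeries.C x, MvPowerSeries.C y] : Fin 4 → MvPowerSeries (Fin 2) A))) (MvPowerSeries.C x)) L).comp lam) ∧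
      (∀ z : L, ∃ a s, s ∉ 𝔔.comap lam ∧ z * algebraMap (blowupAlgebra (Ideal.span (Set.range (![MvPowerSeries.X 0, MvPowerSeries.X 1, MvPowerSeries.C x, MvPowerSeries.C y] : Fin 4 → MvPowerSeries (Fin 2) A))) (MvPowerSeries.C x)) L (lam s) - algebraMap (blowupAlgebra (Ideal.span (Set.range (![MvPowerSeries.X 0, MvPowerSeries.X 1, MvPowerSeries.C x, MvPowerSeries.C y] : Fin 4 → MvPowerSeries (Fin 2) A))) (MvPowerSeries.C x)) L (lam a) ∈ maximalIdeal L) := by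
  classical
  haveI := isRegularLocalRing_mvPowerSeries_of_isRegularLocalRing A 2
  obtain ⟨lam, phi, hsec, hsurj, hlamC, hlam3, hphiC, hker⟩ := chartsOverCentre_section x y hy h0 h1 h3
  obtain ⟨hzP, hdP⟩ := chartsOverCentre_model_rsop x y w hzA hdA
  have hc : ∀ k, (![MvPowerSeries.X 0, MvPowerSeries.X 1, MvPowerSeries.C x, MvPowerSeries.C y] : Fin 4 → MvPowerSeries (Fin 2) A) k ∈ (Ideal.span (Set.range (![MvPowerSeries.X 0, MvPowerSeries.X 1, MvPowerSeries.C x, MvPowerSeries.C y] : Fin 4 → MvPowerSeries (Fin 2) A))) := fun k => Ideal.subset_span ⟨k, rfl⟩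
  -- the chart family `(x, X₀/x, X₁/x, w)` at `𝔔`
  let jJ : Fin 2 → {k : Fin 4 // k ≠ 2} := ![⟨0, by decide⟩, ⟨1, by decide⟩]
  have hjJinj : Function.Injective jJ := by
    intro s s' h
    fin_cases s <;> fin_cases s' <;> first | rfl | exact absurd h (by decide)
  have hjJ𝔔 : ∀ t, blowupAlgebra.gen (Ideal.span (Set.range (![MvPowerSeries.X 0, MvPowerSeries.X 1, MvPowerSeries.C x, MvPowerSeries.C y] : Fin 4 → MvPowerSeries (Fin 2) A))) (MvPowerSeries.C x) ((![MvPowerSeries.X 0, MvPowerSeries.X 1, MvPowerSeries.C x, MvPowerSeries.C y] : Fin 4 → MvPowerSeries (Fin 2) A) (jJ t).1) (hc _) ∈ 𝔔 := by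
    intro t
    fin_cases t
    · exact he0
    · exact he1
  have hrs := chartsOverCentre_isRsopPart_chartFamily_of_eq (![MvPowerSeries.X 0, MvPowerSeries.X 1, MvPowerSeries.C x, MvPowerSeries.C y] : Fin 4 → MvPowerSeries (Fin 2) A) 2 (fun k => MvPowerSeries.C (w k)) hzP hdP
    (Ideal.span (Set.range (![MvPowerSeries.X 0, MvPowerSeries.X 1, MvPowerSeries.C x, MvPowerSeries.C y] : Fin 4 → MvPowerSeries (Fin 2) A))) rfl hc (MvPowerSeries.C x) rfl 𝔔 h𝔔 L jJ hjJinj hjJ𝔔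
  -- `L/(X₀/x, X₁/x)` is a regular local domain with `x ≠ 0`
  have hsub := hrs.comp (![(Fin.castAdd l (0 : Fin 2)).succ, (Fin.castAdd l (1 : Fin 2)).succ]) (by
    intro s s' h
    fin_cases s <;> fin_cases s'
    · rfl
    · exact absurd (Fin.castAdd_injective _ _ (Fin.succ_injective _ h)) (by decide)
    · exact absurd (Fin.castAdd_injective _ _ (Fin.succ_injective _ h)) (by decide)
    · rfl)
  have hze0 : chartFamily (![MvPowerSeries.X 0, MvPowerSeries.X 1, MvPowerSeries.C x, MvPowerSeries.C y] : Fin 4 → MvPowerSeries (Fin 2) A) 2 (fun k => MvPowerSeries.C (w k)) L (algebraMap (MvPowerSeries (Fin 2) A) (blowupAlgebra (Ideal.span (Set.range (![MvPowerSeries.X 0, MvPowerSeries.X 1, MvPowerSeries.C x, MvPowerSeries.C y] : Fin 4 → MvPowerSeries (Fin 2) A))) (MvPowerSeries.C x)))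
      (fun k => blowupAlgebra.gen (Ideal.span (Set.range (![MvPowerSeries.X 0, MvPowerSeries.X 1, MvPowerSeries.C x, MvPowerSeries.C y] : Fin 4 → MvPowerSeries (Fin 2) A))) (MvPowerSeries.C x) ((![MvPowerSeries.X 0, MvPowerSeries.X 1, MvPowerSeries.C x, MvPowerSeries.C y] : Fin 4 → MvPowerSeries (Fin 2) A) k) (hc k)) jJ (Fin.castAdd l (0 : Fin 2)).succ =
      algebraMap (blowupAlgebra (Ideal.span (Set.range (![MvPowerSeries.X 0, MvPowerSeries.X 1, MvPowerSeries.C x, MvPowerSeries.C y] : Fin 4 → MvPowerSeries (Fin 2) A))) (MvPowerSeries.C x)) L (blowupAlgebra.gen (Ideal.span (Set.range (![MvPowerSeries.X 0, MvPowerSeries.X 1, MvPowerSeries.C x, MvPowerSeries.C y] : Fin 4 → MvPowerSeries (Fin 2) A))) (MvPowerSeries.C x) (MvPowerSeries.X 0) h0) := by simp [chartFamily, jJ]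
  have hze1 : chartFamily (![MvPowerSeries.X 0, MvPowerSeries.X 1, MvPowerSeries.C x, MvPowerSeries.C y] : Fin 4 → MvPowerSeries (Fin 2) A) 2 (fun k => MvPowerSeries.C (w k)) L (algebraMap (MvPowerSeries (Fin 2) A) (blowupAlgebra (Ideal.span (Set.range (![MvPowerSeries.X 0, MvPowerSeries.X 1, MvPowerSeries.C x, MvPowerSeries.C y] : Fin 4 → MvPowerSeries (Fin 2) A))) (MvPowerSeries.C x)))
      (fun k => blowupAlgebra.gen (Ideal.span (Set.range (![MvPowerSeries.X 0, MvPowerSeries.X 1, MvPowerSeries.C x, MvPowerSeries.C y] : Fin 4 → MvPowerSeries (Fin 2) A))) (MvPowerSeries.C x) ((![MvPowerSeries.X 0, MvPowerSeries.X 1, MvPowerSeries.C x, MvPowerSeries.C y] : Fin 4 → MvPowerSeries (Fin 2) A) k) (hc k)) jJ (Fin.castAdd l (1 : Fin 2)).succ =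
      algebraMap (blowupAlgebra (Ideal.span (Set.range (![MvPowerSeries.X 0, MvPowerSeries.X 1, MvPowerSeries.C x, MvPowerSeries.C y] : Fin 4 → MvPowerSeries (Fin 2) A))) (MvPowerSeries.C x)) L (blowupAlgebra.gen (Ideal.span (Set.range (![MvPowerSeries.X 0, MvPowerSeries.X 1, MvPowerSeries.C x, MvPowerSeries.C y] : Fin 4 → MvPowerSeries (Fin 2) A))) (MvPowerSeries.C x) (MvPowerSeries.X 1) h1) := by simp [chartFamily, jJ]
  have hz0 : chartFamily (![MvPowerSeries.X 0, MvPowerSeries.X 1, MvPowerSeries.C x, MvPowerSeries.C y] : Fin 4 → MvPowerSeries (Fin 2) A) 2 (fun k => MvPowerSeries.C (w k)) L (algebraMap (MvPowerSeries (Fin 2) A) (blowupAlgebra (Ideal.span (Set.range (![MvPowerSeries.X 0, MvPowerSeries.X 1, MvPowerSeries.C x, MvPowerSeries.C y] : Fin 4 → MvPowerSeries (Fin 2) A))) (MvPowerSeries.C x)))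
      (fun k => blowupAlgebra.gen (Ideal.span (Set.range (![MvPowerSeries.X 0, MvPowerSeries.X 1, MvPowerSeries.C x, MvPowerSeries.C y] : Fin 4 → MvPowerSeries (Fin 2) A))) (MvPowerSeries.C x) ((![MvPowerSeries.X 0, MvPowerSeries.X 1, MvPowerSeries.C x, MvPowerSeries.C y] : Fin 4 → MvPowerSeries (Fin 2) A) k) (hc k)) jJ 0 = algebraMap (blowupAlgebra (Ideal.span (Set.range (![MvPowerSeries.X 0, MvPowerSeries.X 1, MvPowerSeries.C x, MvPowerSeries.C y] : Fin 4 → MvPowerSeries (Fin 2) A))) (MvPowerSeries.C x)) L (algebraMap (MvPowerSeries (Fin 2) A) (blowupAlgebra (Ideal.span (Set.range (![MvPowerSeries.X 0, MvPowerSeries.X 1, MvPowerSeries.C x, MvPowerSeries.C y] : Fin 4 → MvPowerSeries (Fin 2) A))) (MvPowerSeries.C x)) (MvPowerSeries.C x)) := by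
    simp [chartFamily]
  have hrange : Set.range (chartFamily (![MvPowerSeries.X 0, MvPowerSeries.X 1, MvPowerSeries.C x, MvPowerSeries.C y] : Fin 4 → MvPowerSeries (Fin 2) A) 2 (fun k => MvPowerSeries.C (w k)) L (algebraMap (MvPowerSeries (Fin 2) A) (blowupAlgebra (Ideal.span (Set.range (![MvPowerSeries.X 0, MvPowerSeries.X 1, MvPowerSeries.C x, MvPowerSeries.C y] : Fin 4 → MvPowerSeries (Fin 2) A))) (MvPowerSeries.C x)))
      (fun k => blowupAlgebra.gen (Ideal.span (Set.range (![MvPowerSeries.X 0, MvPowerSeries.X 1, MvPowerSeries.C x, MvPowerSeries.C y] : Fin 4 → MvPowerSeries (Fin 2) A))) (MvPowerSeries.C x) ((![MvPowerSeries.X 0, MvPowerSeries.X 1, MvPowerSeries.C x, MvPowerSeries.C y] : Fin 4 → MvPowerSeries (Fin 2) A) k) (hc k)) jJ ∘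
      ![(Fin.castAdd l (0 : Fin 2)).succ, (Fin.castAdd l (1 : Fin 2)).succ]) = {algebraMap (blowupAlgebra (Ideal.span (Set.range (![MvPowerSeries.X 0, MvPowerSeries.X 1, MvPowerSeries.C x, MvPowerSeries.C y] : Fin 4 → MvPowerSeries (Fin 2) A))) (MvPowerSeries.C x)) L (blowupAlgebra.gen (Ideal.span (Set.range (![MvPowerSeries.X 0, MvPowerSeries.X 1, MvPowerSeries.C x, MvPowerSeries.C y] : Fin 4 → MvPowerSeries (Fin 2) A))) (MvPowerSeries.C x) (MvPowerSeries.X 0) h0), algebraMap (blowupAlgebra (Ideal.span (Set.range (![MvPowerSeries.X 0, MvPowerSeries.X 1, MvPowerSeries.C x, MvPowerSeries.C y] : Fin 4 → MvPowerSeries (Fin 2) A))) (MvPowerSeries.C x)) L (blowupAlgebra.gen (Ideal.span (Set.range (![MvPowerSeries.X 0, MvPowerSeries.X 1, MvPowerSeries.C x, MvPowerSeries.C y] : Fin 4 → MvPowerSeries (Fin 2) A))) (MvPowerSeries.C x) (MvPowerSeries.X 1) h1)} := by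
    rw [Set.range_comp, Matrix.range_cons_cons_empty, Set.image_pair, hze0, hze1]
  haveI hregq : IsRegularLocalRing (L ⧸ Ideal.span {algebraMap (blowupAlgebra (Ideal.span (Set.range (![MvPowerSeries.X 0, MvPowerSeries.X 1, MvPowerSeries.C x, MvPowerSeries.C y] : Fin 4 → MvPowerSeries (Fin 2) A))) (MvPowerSeries.C x)) L (blowupAlgebra.gen (Ideal.span (Set.range (![MvPowerSeries.X 0, MvPowerSeries.X 1, MvPowerSeries.C x, MvPowerSeries.C y] : Fin 4 → MvPowerSeries (Fin 2) A))) (MvPowerSeries.C x) (MvPowerSeries.X 0) h0), algebraMap (blowupAlgebra (Ideal.span (Set.range (![MvPowerSeries.X 0, MvPowerSeries.X 1, MvPowerSeries.C x, MvPowerSeries.C y] : Fin 4 → MvPowerSeries (Fin 2) A))) (MvPowerSeries.C x)) L (blowupAlgebra.gen (Ideal.span (Set.range (![MvPowerSeries.X 0, MvPowerSeries.X 1, MvPowerSeries.C x, MvPowerSeries.C y] : Fin 4 → MvPowerSeries (Fin 2) A))) (MvPowerSeries.C x) (MvPowerSeries.X 1) h1)}) := by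
    rw [← hrange]; exact hsub.isRegularLocalRing_quotient
  haveI : IsDomain (L ⧸ Ideal.span {algebraMap (blowupAlgebra (Ideal.span (Set.range (![MvPowerSeries.X 0, MvPowerSeries.X 1, MvPowerSeries.C x, MvPowerSeries.C y] : Fin 4 → MvPowerSeries (Fin 2) A))) (MvPowerSeries.C x)) L (blowupAlgebra.gen (Ideal.span (Set.range (![MvPowerSeries.X 0, MvPowerSeries.X 1, MvPowerSeries.C x, MvPowerSeries.C y] : Fin 4 → MvPowerSeries (Fin 2) A))) (MvPowerSeries.C x) (MvPowerSeries.X 0) h0), algebraMap (blowupAlgebra (Ideal.span (Set.range (![MvPowerSeries.X 0, MvPowerSeries.X 1, MvPowerSeries.C x, MvPowerSeries.C y] : Fin 4 → MvPowerSeries (Fin 2) A))) (MvPowerSeries.C x)) L (blowupAlgebra.gen (Ideal.span (Set.range (![MvPowerSeries.X 0, MvPowerSeries.X 1, MvPowerSeries.C x, MvPowerSeries.C y] : Fin 4 → MvPowerSeries (Fin 2) A))) (MvPowerSeries.C x) (MvPowerSeries.X 1) h1)}) := isDomain_of_isRegularLocalRing _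
  have hP : (Ideal.span {algebraMap (blowupAlgebra (Ideal.span (Set.range (![MvPowerSeries.X 0, MvPowerSeries.X 1, MvPowerSeries.C x, MvPowerSeries.C y] : Fin 4 → MvPowerSeries (Fin 2) A))) (MvPowerSeries.C x)) L (blowupAlgebra.gen (Ideal.span (Set.range (![MvPowerSeries.X 0, MvPowerSeries.X 1, MvPowerSeries.C x, MvPowerSeries.C y] : Fin 4 → MvPowerSeries (Fin 2) A))) (MvPowerSeries.C x) (MvPowerSeries.X 0) h0), algebraMap (blowupAlgebra (Ideal.span (Set.range (![MvPowerSeries.X 0, MvPowerSeries.X 1, MvPowerSeries.C x, MvPowerSeries.C y] : Fin 4 → MvPowerSeries (Fin 2) A))) (MvPowerSeries.C x)) L (blowupAlgebra.gen (Ideal.span (Set.range (![MvPowerSeries.X 0, MvPowerSeries.X 1, MvPowerSeries.C x, MvPowerSeries.C y] : Fin 4 → MvPowerSeries (Fin 2) A))) (MvPowerSeries.C x) (MvPowerSeries.X 1) h1)}).IsPrime :=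
    (Ideal.Quotient.isDomain_iff_prime _).mp inferInstance
  have hxnm : algebraMap (blowupAlgebra (Ideal.span (Set.range (![MvPowerSeries.X 0, MvPowerSeries.X 1, MvPowerSeries.C x, MvPowerSeries.C y] : Fin 4 → MvPowerSeries (Fin 2) A))) (MvPowerSeries.C x)) L (algebraMap (MvPowerSeries (Fin 2) A) (blowupAlgebra (Ideal.span (Set.range (![MvPowerSeries.X 0, MvPowerSeries.X 1, MvPowerSeries.C x, MvPowerSeries.C y] : Fin 4 → MvPowerSeries (Fin 2) A))) (MvPowerSeries.C x)) (MvPowerSeries.C x)) ∉ Ideal.span {algebraMap (blowupAlgebra (Ideal.span (Set.range (![MvPowerSeries.X 0, MvPowerSeries.X 1, MvPowerSeries.C x, MvPowerSeries.C y] : Fin 4 → MvPowerSeries (Fin 2) A))) (MvPowerSeries.C x)) L (blowupAlgebra.gen (Ideal.span (Set.range (![MvPowerSeries.X 0, MvPowerSeries.X 1, MvPowerSeries.C x, MvPowerSeries.C y] : Fin 4 → MvPowerSeries (Fin 2) A))) (MvPowerSeries.C x) (MvPowerSeries.X 0) h0), algebraMap (blowupAlgebra (Ideal.span (Set.range (![MvPowerSeries.X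 0, MvPowerSeries.X 1, MvPowerSeries.C x, MvPowerSeries.C y] : Fin 4 → MvPowerSeries (Fin 2) A))) (MvPowerSeries.C x)) L (blowupAlgebra.gen (Ideal.span (Set.range (![MvPowerSeries.X 0, MvPowerSeries.X 1, MvPowerSeries.C x, MvPowerSeries.C y] : Fin 4 → MvPowerSeries (Fin 2) A))) (MvPowerSeries.C x) (MvPowerSeries.X 1) h1)} := by
    rw [← hz0]
    have := hrs.not_mem_span_image (S := {(Fin.castAdd l (0 : Fin 2)).succ, (Fin.castAdd l (1 : Fin 2)).succ})
      (i := 0) (by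
        simp only [Set.mem_insert_iff, Set.mem_singleton_iff, not_or]
        exact ⟨(Fin.succ_ne_zero _).symm, (Fin.succ_ne_zero _).symm⟩)
    rwa [Set.image_pair, hze0, hze1] at this
  -- (a) every element differs from its retraction by an element of `(X₀/x, X₁/x) L`
  have ha : ∀ b, algebraMap (blowupAlgebra (Ideal.span (Set.range (![MvPowerSeries.X 0, MvPowerSeries.X 1, MvPowerSeries.C x, MvPowerSeries.C y] : Fin 4 → MvPowerSeries (Fin 2) A))) (MvPowerSeries.C x)) L b - algebraMap (blowupAlgebra (Ideal.span (Set.range (![MvPowerSeries.X 0, MvPowerSeries.X 1, MvPowerSeries.C x, MvPowerSeries.C y] : Fin 4 → MvPowerSeries (Fin 2) A))) (MvPowerSeries.C x)) L (lam (phi b)) ∈ Ideal.span {algebraMap (blowupAlgebra (Ideal.span (Set.range (![MvPowerSeries.X 0, MvPowerSeries.X 1, MvPowerSeries.C x, MvPowerSeries.C y] : Fin 4 → MvPowerSeries (Fin 2) A))) (MvPowerSeries.C x)) L (blowupAlgebra.gen (Ideal.span (Set.range (![MvPowerSeries.X 0, MvPowerSeries.X 1, MvPowerSeries.C x, MvPowerSeries.C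 y] : Fin 4 → MvPowerSeries (Fin 2) A))) (MvPowerSeries.C x) (MvPowerSeries.X 0) h0), algebraMap (blowupAlgebra (Ideal.span (Set.range (![MvPowerSeries.X 0, MvPowerSeries.X 1, MvPowerSeries.C x, MvPowerSeries.C y] : Fin 4 → MvPowerSeries (Fin 2) A))) (MvPowerSeries.C x)) L (blowupAlgebra.gen (Ideal.span (Set.range (![MvPowerSeries.X 0, MvPowerSeries.X 1, MvPowerSeries.C x, MvPowerSeries.C y] : Fin 4 → MvPowerSeries (Fin 2) A))) (MvPowerSeries.C x) (MvPowerSeries.X 1) h1)} := by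
    intro b
    obtain ⟨N, hN⟩ := hker b
    have h1 : algebraMap (blowupAlgebra (Ideal.span (Set.range (![MvPowerSeries.X 0, MvPowerSeries.X 1, MvPowerSeries.C x, MvPowerSeries.C y] : Fin 4 → MvPowerSeries (Fin 2) A))) (MvPowerSeries.C x)) L (algebraMap (MvPowerSeries (Fin 2) A) (blowupAlgebra (Ideal.span (Set.range (![MvPowerSeries.X 0, MvPowerSeries.X 1, MvPowerSeries.C x, MvPowerSeries.C y] : Fin 4 → MvPowerSeries (Fin 2) A))) (MvPowerSeries.C x)) (MvPowerSeries.C x)) ^ N * (algebraMap (blowupAlgebra (Ideal.span (Set.range (![MvPowerSeries.X 0, MvPowerSeries.X 1, MvPowerSeries.C x, MvPowerSeries.C y] : Fin 4 → MvPowerSeries (Fin 2) A))) (MvPowerSeries.C x)) L b - algebraMap (blowupAlgebra (Ideal.span (Set.range (![MvPowerSeries.X 0, MvPowerSeries.X 1, MvPowerSeries.C x, MvPowerSeries.C y] : Fin 4 → MvPowerSeries (Fin 2) A))) (MvPowerSeries.C x)) L (lam (phi b))) ∈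
        Ideal.span {algebraMap (blowupAlgebra (Ideal.span (Set.range (![MvPowerSeries.X 0, MvPowerSeries.X 1, MvPowerSeries.C x, MvPowerSeries.C y] : Fin 4 → MvPowerSeries (Fin 2) A))) (MvPowerSeries.C x)) L (blowupAlgebra.gen (Ideal.span (Set.range (![MvPowerSeries.X 0, MvPowerSeries.X 1, MvPowerSeries.C x, MvPowerSeries.C y] : Fin 4 → MvPowerSeries (Fin 2) A))) (MvPowerSeries.C x) (MvPowerSeries.X 0) h0), algebraMap (blowupAlgebra (Ideal.span (Set.range (![MvPowerSeries.X 0, MvPowerSeries.X 1, MvPowerSeries.C x, MvPowerSeries.C y] : Fin 4 → MvPowerSeries (Fin 2) A))) (MvPowerSeries.C x)) L (blowupAlgebra.gen (Ideal.span (Set.range (![MvPowerSeries.X 0, MvPowerSeries.X 1, MvPowerSeries.C x, MvPowerSeries.C y] : Fin 4 → MvPowerSeries (Fin 2) A))) (MvPowerSeries.C x) (MvPowerSeries.X 1) h1)} := by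
      have := Ideal.mem_map_of_mem (algebraMap (blowupAlgebra (Ideal.span (Set.range (![MvPowerSeries.X 0, MvPowerSeries.X 1, MvPowerSeries.C x, MvPowerSeries.C y] : Fin 4 → MvPowerSeries (Fin 2) A))) (MvPowerSeries.C x)) L) hN
      rwa [Ideal.map_span, Set.image_pair, map_mul, map_pow, map_sub] at this
    rcases hP.mem_or_mem h1 with h1 | h1
    · exact absurd (hP.mem_of_pow_mem N h1) hxnm
    · exact h1
  have hspan𝔔 : Ideal.span {algebraMap (blowupAlgebra (Ideal.span (Set.range (![MvPowerSeries.X 0, MvPowerSeries.X 1, MvPowerSeries.C x, MvPowerSeries.C y] : Fin 4 → MvPowerSeries (Fin 2) A))) (MvPowerSeries.C x)) L (blowupAlgebra.gen (Ideal.span (Set.range (![MvPowerSeries.X 0, MvPowerSeries.X 1, MvPowerSeries.C x, MvPowerSeries.C y] : Fin 4 → MvPowerSeries (Fin 2) A))) (MvPowerSeries.C x) (MvPowerSeries.X 0) h0), algebraMap (blowupAlgebra (Ideal.span (Set.range (![MvPowerSeries.X 0, MvPowerSeries.X 1, MvPowerSeries.C x, MvPowerSeries.C y] : Fin 4 → MvPowerSeries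 (Fin 2) A))) (MvPowerSeries.C x)) L (blowupAlgebra.gen (Ideal.span (Set.range (![MvPowerSeries.X 0, MvPowerSeries.X 1, MvPowerSeries.C x, MvPowerSeries.C y] : Fin 4 → MvPowerSeries (Fin 2) A))) (MvPowerSeries.C x) (MvPowerSeries.X 1) h1)} ≤ maximalIdeal L := by
    rw [Ideal.span_le, Set.pair_subset_iff]
    exact ⟨(IsLocalization.AtPrime.to_map_mem_maximal_iff L 𝔔 _).mpr he0,
      (IsLocalization.AtPrime.to_map_mem_maximal_iff L 𝔔 _).mpr he1⟩
  -- (b) `phi(𝔔) ⊆ 𝔔₁`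
  have hb : ∀ b ∈ 𝔔, phi b ∈ 𝔔.comap lam := by
    intro b hb𝔔
    rw [Ideal.mem_comap, ← IsLocalization.AtPrime.to_map_mem_maximal_iff L 𝔔]
    have : algebraMap (blowupAlgebra (Ideal.span (Set.range (![MvPowerSeries.X 0, MvPowerSeries.X 1, MvPowerSeries.C x, MvPowerSeries.C y] : Fin 4 → MvPowerSeries (Fin 2) A))) (MvPowerSeries.C x)) L (lam (phi b)) = algebraMap (blowupAlgebra (Ideal.span (Set.range (![MvPowerSeries.X 0, MvPowerSeries.X 1, MvPowerSeries.C x, MvPowerSeries.C y] : Fin 4 → MvPowerSeries (Fin 2) A))) (MvPowerSeries.C x)) L b - (algebraMap (blowupAlgebra (Ideal.span (Set.range (![MvPowerSeries.X 0, MvPowerSeries.X 1, MvPowerSeries.C x, MvPowerSeries.C y] : Fin 4 → MvPowerSeries (Fin 2) A))) (MvPowerSeries.C x)) L b - algebraMap (blowupAlgebra (Ideal.span (Set.range (![MvPowerSeries.X 0, MvPowerSeries.X 1, MvPowerSeries.C x, MvPowerSeries.C y] : Fin 4 → MvPowerSeries (Fin 2) A))) (MvPowerSeries.C x)) L (lam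 (phi b))) := by ring
    rw [this]
    exact Ideal.sub_mem _ ((IsLocalization.AtPrime.to_map_mem_maximal_iff L 𝔔 _).mpr hb𝔔)
      (hspan𝔔 (ha b))
  -- (c) `𝔔₁` is maximal
  haveI hprime : (𝔔.comap lam).IsPrime := Ideal.comap_isPrime lam 𝔔
  have hle : 𝔔.map phi ≤ 𝔔.comap lam := by
    rw [Ideal.map_le_iff_le_comap]
    intro b hb𝔔
    exact hb b hb𝔔
  have hmax : (𝔔.comap lam).IsMaximal := by
    rcases Ideal.map_eq_top_or_isMaximal_of_surjective phi hsurj (I := 𝔔) inferInstance with h | h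
    · exact absurd (eq_top_iff.mpr (h ▸ hle)) hprime.ne_top
    · have heq := h.eq_of_le hprime.ne_top hle
      rw [heq] at h
      exact h
  -- (d) `𝔔₁` lies over `𝔪_A`
  have hd : (𝔔.comap lam).comap (algebraMap A (blowupAlgebra (Ideal.span (Set.range ![x, y])) x)) = maximalIdeal A := by
    ext a
    rw [Ideal.mem_comap, Ideal.mem_comap, hlamC, ← Ideal.mem_comap, h𝔔,
      mem_maximalIdeal_mvPowerSeries_iff, MvPowerSeries.constantCoeff_C]
  -- (e) the maximal ideal
  have he : maximalIdeal L = Ideal.span {algebraMap (blowupAlgebra (Ideal.span (Set.range (![MvPowerSeries.X 0, MvPowerSeries.X 1, MvPowerSeries.C x, MvPowerSeries.C y] : Fin 4 → MvPowerSeries (Fin 2) A))) (MvPowerSeries.C x)) L (blowupAlgebra.gen (Ideal.span (Set.range (![MvPowerSeries.X 0, MvPowerSeries.X 1, MvPowerSeries.C x, MvPowerSeries.C y] : Fin 4 → MvPowerSeries (Fin 2) A))) (MvPowerSeries.C x) (MvPowerSeries.X 0) h0), algebraMap (blowupAlgebra (Ideal.span (Set.range (![MvPowerSeries.X 0, MvPowerSeries.X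 1, MvPowerSeries.C x, MvPowerSeries.C y] : Fin 4 → MvPowerSeries (Fin 2) A))) (MvPowerSeries.C x)) L (blowupAlgebra.gen (Ideal.span (Set.range (![MvPowerSeries.X 0, MvPowerSeries.X 1, MvPowerSeries.C x, MvPowerSeries.C y] : Fin 4 → MvPowerSeries (Fin 2) A))) (MvPowerSeries.C x) (MvPowerSeries.X 1) h1)} ⊔ (𝔔.comap lam).map ((algebraMap (blowupAlgebra (Ideal.span (Set.range (![MvPowerSeries.X 0, MvPowerSeries.X 1, MvPowerSeries.C x, MvPowerSeries.C y] : Fin 4 → MvPowerSeries (Fin 2) A))) (MvPowerSeries.C x)) L).comp lam) := by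
    apply le_antisymm
    · rw [← IsLocalization.AtPrime.map_eq_maximalIdeal 𝔔 L, Ideal.map_le_iff_le_comap]
      intro b hb𝔔
      rw [Ideal.mem_comap, show algebraMap (blowupAlgebra (Ideal.span (Set.range (![MvPowerSeries.X 0, MvPowerSeries.X 1, MvPowerSeries.C x, MvPowerSeries.C y] : Fin 4 → MvPowerSeries (Fin 2) A))) (MvPowerSeries.C x)) L b = (algebraMap (blowupAlgebra (Ideal.span (Set.range (![MvPowerSeries.X 0, MvPowerSeries.X 1, MvPowerSeries.C x, MvPowerSeries.C y] : Fin 4 → MvPowerSeries (Fin 2) A))) (MvPowerSeries.C x)) L b - algebraMap (blowupAlgebra (Ideal.span (Set.range (![MvPowerSeries.X 0, MvPowerSeries.X 1, MvPowerSeries.C x, MvPowerSeries.C y] : Fin 4 → MvPowerSeries (Fin 2) A))) (MvPowerSeries.C x)) L (lam (phi b))) + (algebraMap (blowupAlgebra (Ideal.span (Set.range (![MvPowerSeries.X 0, MvPowerSeries.X 1, MvPowerSeries.C x, MvPowerSeries.C y] : Fin 4 → MvPowerSeries (Fin 2) A))) (MvPowerSeries.C x)) L).comp lam (phi b) by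
        simp]
      exact Ideal.add_mem _ (Ideal.mem_sup_left (ha b)) (Ideal.mem_sup_right (Ideal.mem_map_of_mem _ (hb b hb𝔔)))
    · refine sup_le hspan𝔔 ?_
      rw [Ideal.map_le_iff_le_comap]
      intro a ha'
      rw [Ideal.mem_comap, RingHom.comp_apply, IsLocalization.AtPrime.to_map_mem_maximal_iff L 𝔔]
      exact ha'
  -- (f) the residue fields agree
  refine ⟨lam, phi, hsec, hsurj, hlamC, hlam3, ha, hb, hmax, hd, he, fun z => ?_⟩
  obtain ⟨⟨b, s⟩, hbs⟩ := IsLocalization.surj 𝔔.primeCompl z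
  refine ⟨phi b, phi s, fun hs => ?_, ?_⟩
  · apply s.2
    rw [Ideal.mem_comap, ← IsLocalization.AtPrime.to_map_mem_maximal_iff L 𝔔] at hs
    have hs' : algebraMap (blowupAlgebra (Ideal.span (Set.range (![MvPowerSeries.X 0, MvPowerSeries.X 1, MvPowerSeries.C x, MvPowerSeries.C y] : Fin 4 → MvPowerSeries (Fin 2) A))) (MvPowerSeries.C x)) L s ∈ maximalIdeal L := by
      have : algebraMap (blowupAlgebra (Ideal.span (Set.range (![MvPowerSeries.X 0, MvPowerSeries.X 1, MvPowerSeries.C x, MvPowerSeries.C y] : Fin 4 → MvPowerSeries (Fin 2) A))) (MvPowerSeries.C x)) L s = (algebraMap (blowupAlgebra (Ideal.span (Set.range (![MvPowerSeries.X 0, MvPowerSeries.X 1, MvPowerSeries.C x, MvPowerSeries.C y] : Fin 4 → MvPowerSeries (Fin 2) A))) (MvPowerSeries.C x)) L s - algebraMap (blowupAlgebra (Ideal.span (Set.range (![MvPowerSeries.X 0, MvPowerSeries.X 1, MvPowerSeries.C x, MvPowerSeries.C y] : Fin 4 → MvPowerSeries (Fin 2) A))) (MvPowerSeries.C x)) L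 (lam (phi s))) + algebraMap (blowupAlgebra (Ideal.span (Set.range (![MvPowerSeries.X 0, MvPowerSeries.X 1, MvPowerSeries.C x, MvPowerSeries.C y] : Fin 4 → MvPowerSeries (Fin 2) A))) (MvPowerSeries.C x)) L (lam (phi s)) := by ring
      rw [this]
      exact Ideal.add_mem _ (hspan𝔔 (ha s)) hs
    exact (IsLocalization.AtPrime.to_map_mem_maximal_iff L 𝔔 _).mp hs'
  · have : z * algebraMap (blowupAlgebra (Ideal.span (Set.range (![MvPowerSeries.X 0, MvPowerSeries.X 1, MvPowerSeries.C x, MvPowerSeries.C y] : Fin 4 → MvPowerSeries (Fin 2) A))) (MvPowerSeries.C x)) L (lam (phi s)) - algebraMap (blowupAlgebra (Ideal.span (Set.range (![MvPowerSeries.X 0, MvPowerSeries.X 1, MvPowerSeries.C x, MvPowerSeries.C y] : Fin 4 → MvPowerSeries (Fin 2) A))) (MvPowerSeries.C x)) L (lam (phi b)) =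
        (algebraMap (blowupAlgebra (Ideal.span (Set.range (![MvPowerSeries.X 0, MvPowerSeries.X 1, MvPowerSeries.C x, MvPowerSeries.C y] : Fin 4 → MvPowerSeries (Fin 2) A))) (MvPowerSeries.C x)) L b - algebraMap (blowupAlgebra (Ideal.span (Set.range (![MvPowerSeries.X 0, MvPowerSeries.X 1, MvPowerSeries.C x, MvPowerSeries.C y] : Fin 4 → MvPowerSeries (Fin 2) A))) (MvPowerSeries.C x)) L (lam (phi b))) - z * (algebraMap (blowupAlgebra (Ideal.span (Set.range (![MvPowerSeries.X 0, MvPowerSeries.X 1, MvPowerSeries.C x, MvPowerSeries.C y] : Fin 4 → MvPowerSeries (Fin 2) A))) (MvPowerSeries.C x)) L s - algebraMap (blowupAlgebra (Ideal.span (Set.range (![MvPowerSeries.X 0, MvPowerSeries.X 1, MvPowerSeries.C x, MvPowerSeries.C y] : Fin 4 → MvPowerSeries (Fin 2) A))) (MvPowerSeries.C x)) L (lam (phi s))) := by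
      rw [← hbs]; ring
    rw [this]
    exact Ideal.sub_mem _ (hspan𝔔 (ha b)) (Ideal.mul_mem_left _ _ (hspan𝔔 (ha s)))

end Summit.ResolutionOfSingularities.ResolutionOfSingularities.Theorems

end
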